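import Summits.CriticalPhenomena.CardyFormulaZ2.Theorems.CardyMagicRigidityNestingRigidityNeckCoveringA
import HarnessLib

/-!
# The covering lemma for `𝔅 = THook ∖ THookBig` (stub S11, road map item 1): minimal families of small blobs

`avoidSet`, `pathIn_bigRoute_of_avoid` (a path avoiding all small inner-touching blobs runs in `bigRoute`), and
`covering_B`: for a minimal blocking family of small blobs, (i) the two crossings are not connected in `avoidSet F` and EVERY
family blob is adjacent to both sides (the structural input of the remaining "touching necklace" bound of the road map), and
(ii) every sub-family / centre / scale node carries the honest cluster-form four-arm event.
-/

noncomputable section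

namespace Summit.CriticalPhenomena.CardyFormulaZ2.Cruxes.NestingRigidity.PinchResampling

open MeasureTheory Set Literature.Probability.Percolation Literature.Probability.LatticeModels
open scoped symmDiff

section CoveringB

variable {ℓ lam s : ℕ} {x o : Site 2} {η : SiteConfig (Site 2)}

/-! #### The covering lemma for `𝔅` (small blobs as bridges) -/

/-- The big ball minus the blobs of a family of collar sites. -/
def avoidSet (s : ℕ) (x : Site 2) (η : SiteConfig (Site 2)) (F : Set (Site 2)) : Set (Site 2) :=
  tBall x (2 * s) \ ⋃ c ∈ F, blobOf (tColourGraph η true) (tBall x (2 * s) \ tBall x s) c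

/-- `avoidSet` is antitone in the family. -/
theorem avoidSet_mono {F G : Set (Site 2)} (h : F ⊆ G) : avoidSet s x η G ⊆ avoidSet s x η F := by
  intro z hz
  refine ⟨hz.1, fun hz' ↦ hz.2 ?_⟩
  simp only [mem_iUnion, exists_prop] at hz' ⊢
  obtain ⟨c, hc, hzc⟩ := hz'
  exact ⟨c, h hc, hzc⟩

/-- **A path of `Λ_{2s}(x)` from a crossing that avoids ALL small inner-touching open blobs runs inside `bigRoute`.** -/
theorem pathIn_bigRoute_of_avoid {v z : Site 2} (hv : IsCrossing triGraph (tColourGraph η true) (tBall x s) (tBall x (2 * s)) v)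
    (hvbig : ∃ w ∈ blobOf (tColourGraph η true) (tBall x (2 * s) \ tBall x s) v,
      ∃ w' ∈ blobOf (tColourGraph η true) (tBall x (2 * s) \ tBall x s) v, (lam : ℤ) ≤ triNorm (w - w'))
    (hvη : v ∈ η)
    (hp : PathIn (tColourGraph η true) (avoidSet s x η {c | c ∈ η ∧ c ∈ innerLayer triGraph (tBall x s) (tBall x (2 * s)) ∧
      ¬ ∃ w ∈ blobOf (tColourGraph η true) (tBall x (2 * s) \ tBall x s) c,
        ∃ w' ∈ blobOf (tColourGraph η true) (tBall x (2 * s) \ tBall x s) c, (lam : ℤ) ≤ triNorm (w - w')}) v z) :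
    PathIn triGraph (bigRoute lam s x η ∩ tBall x (2 * s)) v z ∧
      (z ∉ tBall x s → (∃ w ∈ blobOf (tColourGraph η true) (tBall x (2 * s) \ tBall x s) z,
          w ∈ innerLayer triGraph (tBall x s) (tBall x (2 * s))) ∧
        ∃ w ∈ blobOf (tColourGraph η true) (tBall x (2 * s) \ tBall x s) z,
          ∃ w' ∈ blobOf (tColourGraph η true) (tBall x (2 * s) \ tBall x s) z, (lam : ℤ) ≤ triNorm (w - w')) := by
  set K := tBall x s with hK
  set O := tBall x (2 * s) with hO
  set H := tColourGraph η true with hH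
  have hHG : ∀ {a b : Site 2}, H.Adj a b → triGraph.Adj a b ∧ a ∈ η ∧ b ∈ η := fun hab ↦ by
    rw [hH, tColourGraph_true, siteOpenGraph_adj] at hab; exact hab
  obtain ⟨hv0, p⟩ := hp
  induction p with
  | refl =>
    have hvA : v ∈ O \ K := hv.1.1
    refine ⟨PathIn.refl ⟨⟨hvη, Or.inr ⟨hvbig, v, NeckCoarse.self_mem_blobOf hvA, hv.1⟩⟩, hvA.1⟩, fun _ ↦
      ⟨⟨v, NeckCoarse.self_mem_blobOf hvA, hv.1⟩, hvbig⟩⟩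
  | @tail y z hvy hyz ih =>
    obtain ⟨hadj, hzS⟩ := hyz
    obtain ⟨hG, hyη, hzη⟩ := hHG hadj
    obtain ⟨ihp, ihA⟩ := ih
    have hyO : y ∈ O := (PathIn.right_mem ihp).2
    have hzO : z ∈ O := hzS.1
    by_cases hzK : z ∈ K
    · exact ⟨ihp.tail hG ⟨⟨hzη, Or.inl hzK⟩, hzO⟩, fun h ↦ (h hzK).elim⟩
    · have hzA : z ∈ O \ K := ⟨hzO, hzK⟩
      -- the blob of `z` touches the inner layer and is big
      have hprops : (∃ w ∈ blobOf H (O \ K) z, w ∈ innerLayer triGraph K O) ∧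
          ∃ w ∈ blobOf H (O \ K) z, ∃ w' ∈ blobOf H (O \ K) z, (lam : ℤ) ≤ triNorm (w - w') := by
        by_cases hyK : y ∈ K
        · have hzL : z ∈ innerLayer triGraph K O := NeckCoarse.mem_innerLayer_of_adj hzA hyK hG.symm
          refine ⟨⟨z, NeckCoarse.self_mem_blobOf hzA, hzL⟩, ?_⟩
          by_contra hsmall
          refine hzS.2 ?_
          simp only [mem_iUnion, mem_setOf_eq, exists_prop]
          exact ⟨z, ⟨hzη, hzL, hsmall⟩, NeckCoarse.self_mem_blobOf hzA⟩
        · obtain ⟨h1, h2⟩ := ihA hyK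
          have hzy : blobOf H (O \ K) z = blobOf H (O \ K) y :=
            NeckCoarse.blobOf_eq_of_mem (PathIn.of_adj ⟨hyO, hyK⟩ hzA hadj)
          rw [hzy]
          exact ⟨h1, h2⟩
      exact ⟨ihp.tail hG ⟨⟨hzη, Or.inr ⟨hprops.2, hprops.1⟩⟩, hzO⟩, fun _ ↦ hprops⟩

/-- Points of a small blob are within `lam - 1` of each other. -/
theorem triNorm_sub_lt_of_small {c z z' : Site 2}
    (hsmall : ¬ ∃ w ∈ blobOf (tColourGraph η true) (tBall x (2 * s) \ tBall x s) c,
      ∃ w' ∈ blobOf (tColourGraph η true) (tBall x (2 * s) \ tBall x s) c, (lam : ℤ) ≤ triNorm (w - w'))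
    (hz : z ∈ blobOf (tColourGraph η true) (tBall x (2 * s) \ tBall x s) c)
    (hz' : z' ∈ blobOf (tColourGraph η true) (tBall x (2 * s) \ tBall x s) c) : triNorm (z - z') < lam := by
  by_contra h
  exact hsmall ⟨z, hz, z', hz', not_lt.1 h⟩

/-- **Covering lemma for `𝔅` (road map, item 1; deterministic, general node form).**  On `THook ∖ THookBig` (`1 ≤ lam`,
`lam + 1 ≤ s`) there is a nonempty finite family `F` of inner-layer sites of SMALL open blobs — a MINIMAL family whose blobs
every open connection of two given non-`bigRoute`-connected crossings must meet — such that for EVERY nonempty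
sub-family `𝒩 ⊆ F` and every inner-layer centre `w` with the sites of `𝒩` inside `Λ_Δ(w)` and those of `F ∖ 𝒩` outside
`Λ_{Γ-1}(w)`, every annulus `{r ≤ |· - w|_𝕋 ≤ R}` with `Δ + lam + 1 ≤ r ≤ R`, `R + lam ≤ Γ`, `R + 2 ≤ s` is crossed by two open
paths lying in distinct open clusters OF THE ANNULUS. -/
theorem covering_B (hlam : 1 ≤ lam) (hls : lam + 1 ≤ s) (hH : η ∈ THook x x s s) (hnB : η ∉ THookBig lam s x) :
    ∃ F : Finset (Site 2), (∀ c ∈ F, c ∈ η ∧ c ∈ innerLayer triGraph (tBall x s) (tBall x (2 * s)) ∧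
        ¬ ∃ w ∈ blobOf (tColourGraph η true) (tBall x (2 * s) \ tBall x s) c,
          ∃ w' ∈ blobOf (tColourGraph η true) (tBall x (2 * s) \ tBall x s) c, (lam : ℤ) ≤ triNorm (w - w')) ∧
      F.Nonempty ∧
      (∃ v v' : Site 2, IsCrossing triGraph (tColourGraph η true) (tBall x s) (tBall x (2 * s)) v ∧
        IsCrossing triGraph (tColourGraph η true) (tBall x s) (tBall x (2 * s)) v' ∧
        ¬ PathIn (tColourGraph η true) (avoidSet s x η ↑F) v v' ∧
        ∀ c ∈ F, ∃ a₁ c₁ a₂ c₂, PathIn (tColourGraph η true) (avoidSet s x η ↑F) v a₁ ∧ (tColourGraph η true).Adj a₁ c₁ ∧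
          c₁ ∈ blobOf (tColourGraph η true) (tBall x (2 * s) \ tBall x s) c ∧
          PathIn (tColourGraph η true) (avoidSet s x η ↑F) v' a₂ ∧ (tColourGraph η true).Adj a₂ c₂ ∧
          c₂ ∈ blobOf (tColourGraph η true) (tBall x (2 * s) \ tBall x s) c) ∧
      ∀ 𝒩 ⊆ F, 𝒩.Nonempty → ∀ (w : Site 2) (Δ r R Γ : ℕ),
        w ∈ innerLayer triGraph (tBall x s) (tBall x (2 * s)) →
        (∀ c ∈ 𝒩, triNorm (c - w) ≤ Δ) → (∀ c ∈ F, c ∉ 𝒩 → (Γ : ℤ) ≤ triNorm (c - w)) →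
        Δ + lam + 1 ≤ r → r ≤ R → R + lam ≤ Γ → R + 2 ≤ s →
        ∃ p₁ q₁ p₂ q₂, triNorm (p₁ - w) = r ∧ triNorm (q₁ - w) = R ∧ triNorm (p₂ - w) = r ∧ triNorm (q₂ - w) = R ∧
          PathIn (tColourGraph η true) (tAnn w r R) p₁ q₁ ∧ PathIn (tColourGraph η true) (tAnn w r R) p₂ q₂ ∧
          ¬ PathIn (tColourGraph η true) (tAnn w r R) p₁ p₂ := by
  classical
  set K := tBall x s with hK
  set O := tBall x (2 * s) with hO
  set H := tColourGraph η true with hH'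
  -- two crossings, hooked up but not through the big blobs
  have hvw : ∃ v v', IsCrossing triGraph H K O v ∧ IsCrossing triGraph H K O v' ∧
      ¬ PathIn triGraph (bigRoute lam s x η ∩ O) v v' := by
    by_contra hcon
    push Not at hcon
    exact hnB fun v v' hv hv' ↦ hcon v v' hv hv'
  obtain ⟨v, v', hv, hv', hnvv'⟩ := hvw
  have hreal : PathIn H O v v' := hH v v' hv hv'
  -- crossings are open with big blobs
  have hbigc : ∀ {v : Site 2}, IsCrossing triGraph H K O v →
      (∃ w₁ ∈ blobOf H (O \ K) v, ∃ w₂ ∈ blobOf H (O \ K) v, (lam : ℤ) ≤ triNorm (w₁ - w₂)) ∧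
      (∃ w₁ ∈ blobOf H (O \ K) v, w₁ ∈ outerLayer triGraph K O) ∧ v ∈ η := by
    rintro v ⟨hvL, w₁, hw₁o, hp⟩
    have h1 := triNorm_le_of_mem_innerLayer hvL
    have h2 := le_triNorm_of_mem_outerLayer hw₁o
    have h3 := triNorm_sub_le_triNorm_sub_add w₁ v x
    have hne : v ≠ w₁ := by
      rintro rfl
      push_cast at h2
      omega
    refine ⟨⟨w₁, hp, v, NeckCoarse.self_mem_blobOf hvL.1, ?_⟩, ⟨w₁, hp, hw₁o⟩, ?_⟩
    · push_cast at h2; omega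
    · rw [hH', tColourGraph_true] at hp
      exact NeckCoarse.mem_of_pathIn_ne hp hne
  -- the universe of small inner-touching open blob sites, and the avoidance property
  let Sm : Set (Site 2) := {c | c ∈ η ∧ c ∈ innerLayer triGraph K O ∧
    ¬ ∃ w ∈ blobOf H (O \ K) c, ∃ w' ∈ blobOf H (O \ K) c, (lam : ℤ) ≤ triNorm (w - w')}
  have hfin : Sm.Finite := (tBall_finite x (2 * s)).subset fun c hc ↦ hc.2.1.1.1
  set U : Finset (Site 2) := hfin.toFinset with hU
  have hUS : (↑U : Set (Site 2)) = Sm := by simp [hU]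
  let P : Finset (Site 2) → Prop := fun F ↦ ¬ PathIn H (avoidSet s x η ↑F) v v'
  have hPU : P U := by
    intro hp
    rw [hUS] at hp
    exact hnvv' (pathIn_bigRoute_of_avoid hv (hbigc hv).1 (hbigc hv).2.2 hp).1
  set 𝒞 := U.powerset.filter P with h𝒞
  have hU𝒞 : U ∈ 𝒞 := Finset.mem_filter.2 ⟨Finset.mem_powerset.2 subset_rfl, hPU⟩
  obtain ⟨F, hF𝒞, hFmin⟩ := Finset.exists_min_image 𝒞 Finset.card ⟨U, hU𝒞⟩
  obtain ⟨hFU, hFP⟩ := Finset.mem_filter.1 hF𝒞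
  have hFU' : ∀ c ∈ F, c ∈ Sm := fun c hc ↦ by
    have := Finset.mem_powerset.1 hFU hc
    simpa [hU] using this
  have hmin : ∀ 𝒩 ⊆ F, 𝒩.Nonempty → PathIn H (avoidSet s x η ↑(F \ 𝒩)) v v' := by
    intro 𝒩 h𝒩 hne
    by_contra hch
    have hmem : F \ 𝒩 ∈ 𝒞 :=
      Finset.mem_filter.2 ⟨Finset.mem_powerset.2 (Finset.sdiff_subset.trans (Finset.mem_powerset.1 hFU)), hch⟩
    have h1 := hFmin _ hmem
    have h2 : (F \ 𝒩).card < F.card := by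
      obtain ⟨e, he⟩ := hne
      exact Finset.card_lt_card (Finset.sdiff_ssubset h𝒩 ⟨e, he⟩)
    omega
  -- big blobs avoid the family; in particular the crossing blobs do
  have hbig_avoid : ∀ {u z : Site 2}, (∃ w₁ ∈ blobOf H (O \ K) u, ∃ w₂ ∈ blobOf H (O \ K) u, (lam : ℤ) ≤ triNorm (w₁ - w₂)) →
      z ∈ blobOf H (O \ K) u → z ∈ avoidSet s x η ↑F := by
    intro u z hbig hz
    refine ⟨(PathIn.right_mem hz).1, fun hz' ↦ ?_⟩
    simp only [mem_iUnion, Finset.mem_coe, exists_prop] at hz'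
    obtain ⟨c, hc, hzc⟩ := hz'
    have hcu : blobOf H (O \ K) c = blobOf H (O \ K) u :=
      (NeckCoarse.blobOf_eq_of_mem hzc).symm.trans (NeckCoarse.blobOf_eq_of_mem hz)
    refine (hFU' c hc).2.2 ?_
    rw [hcu]; exact hbig
  have memU : ∀ (S : Set (Site 2)) (z : Site 2),
      z ∈ (⋃ c ∈ S, blobOf H (O \ K) c) ↔ ∃ c ∈ S, z ∈ blobOf H (O \ K) c := fun S z ↦ by
    simp only [mem_iUnion, exists_prop]
  -- `avoidSet F` is `avoidSet (F ∖ 𝒩)` minus the `𝒩`-blobs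
  have hsplit : ∀ (𝒩 : Finset (Site 2)),
      (⋃ c ∈ (↑𝒩 : Set (Site 2)), blobOf H (O \ K) c)ᶜ ∩ avoidSet s x η ↑(F \ 𝒩) ⊆ avoidSet s x η ↑F := by
    rintro 𝒩 z ⟨hzN, hzO, hzFN⟩
    refine ⟨hzO, fun hzF ↦ ?_⟩
    obtain ⟨c, hc, hzc⟩ := (memU _ z).1 hzF
    by_cases hcN : c ∈ 𝒩
    · exact hzN ((memU _ z).2 ⟨c, Finset.mem_coe.2 hcN, hzc⟩)
    · exact hzFN ((memU _ z).2 ⟨c, Finset.mem_coe.2 (Finset.mem_sdiff.2 ⟨Finset.mem_coe.1 hc, hcN⟩), hzc⟩)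
  have hside : ∀ (𝒩 : Finset (Site 2)), 𝒩 ⊆ F → ∀ {c₀ c₁ : Site 2}, IsCrossing triGraph H K O c₀ →
      PathIn H (avoidSet s x η ↑(F \ 𝒩)) c₀ c₁ → ¬ PathIn H (avoidSet s x η ↑F) c₀ c₁ →
      ∃ a cc, PathIn H (avoidSet s x η ↑F) c₀ a ∧ H.Adj a cc ∧
        ∃ c ∈ 𝒩, cc ∈ blobOf H (O \ K) c := by
    intro 𝒩 h𝒩 c₀ c₁ hc₀ hp hn
    have hc₀R : c₀ ∈ (⋃ c ∈ (↑𝒩 : Set (Site 2)), blobOf H (O \ K) c)ᶜ := by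
      intro h0
      obtain ⟨c, hc, h⟩ := (memU _ c₀).1 h0
      exact (hbig_avoid (hbigc hc₀).1 (NeckCoarse.self_mem_blobOf hc₀.1.1)).2
        ((memU _ c₀).2 ⟨c, Finset.mem_coe.2 (h𝒩 (Finset.mem_coe.1 hc)), h⟩)
    rcases hp.exit_or (R := (⋃ c ∈ (↑𝒩 : Set (Site 2)), blobOf H (O \ K) c)ᶜ) hc₀R with
      hstay | ⟨a, cc, -, hccR, -, hadj, hpref⟩
    · exact (hn (hstay.mono (hsplit 𝒩))).elim
    · refine ⟨a, cc, hpref.mono (hsplit 𝒩), hadj, ?_⟩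
      simp only [mem_compl_iff, not_not] at hccR
      obtain ⟨c, hc, hcc⟩ := (memU _ cc).1 hccR
      exact ⟨c, Finset.mem_coe.1 hc, hcc⟩
  refine ⟨F, fun c hc ↦ hFU' c hc, ?_, ⟨v, v', hv, hv', hFP, fun c hc ↦ ?_⟩, ?_⟩
  · by_contra hemp
    rw [Finset.not_nonempty_iff_eq_empty] at hemp
    refine hFP (hreal.mono fun z hz ↦ ⟨hz, ?_⟩)
    simp [hemp]
  · -- every family blob is adjacent to both sides
    have hsub : ({c} : Finset (Site 2)) ⊆ F := Finset.singleton_subset_iff.2 hc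
    have hρ := hmin {c} hsub ⟨c, Finset.mem_singleton_self c⟩
    obtain ⟨a₁, c₁, hpa₁, hadj₁, k₁, hk₁, hc₁⟩ := hside {c} hsub hv hρ hFP
    obtain ⟨a₂, c₂, hpa₂, hadj₂, k₂, hk₂, hc₂⟩ := hside {c} hsub hv' hρ.symm fun h ↦ hFP h.symm
    rw [Finset.mem_singleton] at hk₁ hk₂
    subst hk₁; subst hk₂
    exact ⟨a₁, c₁, a₂, c₂, hpa₁, hadj₁, hc₁, hpa₂, hadj₂, hc₂⟩
  intro 𝒩 h𝒩 hne w Δ r R Γ hw hΔ hΓ hr hrR hRΓ hRs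
  -- the annulus avoids the family
  have hAnn : tAnn w r R ⊆ avoidSet s x η ↑F := by
    intro z hz
    refine ⟨tAnn_subset_tBall hw (by omega) hz, fun hz' ↦ ?_⟩
    simp only [mem_iUnion, Finset.mem_coe, exists_prop] at hz'
    obtain ⟨c, hc, hzc⟩ := hz'
    have hd := triNorm_sub_lt_of_small (hFU' c hc).2.2 hzc (NeckCoarse.self_mem_blobOf (hFU' c hc).2.1.1)
    have h1 := triNorm_sub_le_triNorm_sub_add z c w
    have h2 := triNorm_sub_le_triNorm_sub_add c z w
    have h3 : triNorm (c - z) = triNorm (z - c) := by rw [← triNorm_neg, neg_sub]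
    obtain ⟨hzr, hzR⟩ := hz
    by_cases hcN : c ∈ 𝒩
    · have := hΔ c hcN; omega
    · have := hΓ c hc hcN; omega
  -- a connection avoiding `F ∖ 𝒩` exists and must enter an `𝒩`-blob: first entry from each side
  have hρ := hmin 𝒩 h𝒩 hne
  obtain ⟨a₁, c₁, hpa₁, hadj₁, k₁, hk₁, hc₁⟩ := hside 𝒩 h𝒩 hv hρ hFP
  obtain ⟨a₂, c₂, hpa₂, hadj₂, k₂, hk₂, hc₂⟩ := hside 𝒩 h𝒩 hv' hρ.symm fun h ↦ hFP h.symm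
  -- the two sides are not connected inside the avoiding set
  have hn12 : ¬ PathIn H (avoidSet s x η ↑F) a₁ a₂ := fun h ↦ hFP ((hpa₁.trans h).trans hpa₂.symm)
  have hHG : ∀ {a b : Site 2}, H.Adj a b → triGraph.Adj a b := fun hab ↦ by
    rw [hH', tColourGraph_true, siteOpenGraph_adj] at hab; exact hab.1
  -- near
  have hnear : ∀ {a cc k : Site 2}, H.Adj a cc → k ∈ 𝒩 → cc ∈ blobOf H (O \ K) k → triNorm (a - w) < r := by
    intro a cc k hadj hk hcc
    have h1 : triNorm (a - cc) ≤ 1 := by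
      have := triNorm_sub_le_of_adj (hHG hadj).symm cc
      simp at this
      have h0 : triNorm (cc - cc) = 0 := by simp
      omega
    have h2 := triNorm_sub_lt_of_small (hFU' k (h𝒩 hk)).2.2 hcc (NeckCoarse.self_mem_blobOf (hFU' k (h𝒩 hk)).2.1.1)
    have h3 := hΔ k hk
    have h4 := triNorm_sub_le_triNorm_sub_add a cc w
    have h5 := triNorm_sub_le_triNorm_sub_add cc k w
    omega
  -- far: through the crossing blob to the outer layer
  have hfar : ∀ {c₀ a : Site 2}, IsCrossing triGraph H K O c₀ → PathIn H (avoidSet s x η ↑F) c₀ a →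
      ∃ q, PathIn H (avoidSet s x η ↑F) a q ∧ (R : ℤ) ≤ triNorm (q - w) := by
    intro c₀ a hc₀ hp
    obtain ⟨hbig, ⟨q, hq, hqo⟩, -⟩ := hbigc hc₀
    -- restrict the crossing path to `avoidSet`, which contains every point reachable along the way
    have hrestr : ∀ {A B : Set (Site 2)} {u v : Site 2}, PathIn H A u v → (∀ z, PathIn H A u z → z ∈ B) →
        PathIn H B u v := by
      intro A B u v h hB
      obtain ⟨hu, p⟩ := h
      have hu' : u ∈ B := hB u (PathIn.refl hu)
      induction p with
      | refl => exact PathIn.refl hu'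
      | @tail y z hyp hyz ih => exact (ih).tail hyz.1 (hB z ⟨hu, hyp.tail hyz⟩)
    refine ⟨q, hp.symm.trans (hrestr hq fun z hz ↦ hbig_avoid hbig hz), ?_⟩
    · have h1 := le_triNorm_of_mem_outerLayer hqo
      have h2 := triNorm_le_of_mem_innerLayer hw
      have h3 := triNorm_sub_le_triNorm_sub_add q w x
      push_cast at h1; omega
  obtain ⟨q₁', ha₁q, hq₁R⟩ := hfar hv hpa₁
  obtain ⟨q₂', ha₂q, hq₂R⟩ := hfar hv' hpa₂
  obtain ⟨p₁, q₁, hp₁, hq₁, hcross₁, ha₁p₁⟩ := exists_crossing_of_pathIn hrR (hnear hadj₁ hk₁ hc₁) hq₁R ha₁q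
  obtain ⟨p₂, q₂, hp₂, hq₂, hcross₂, ha₂p₂⟩ := exists_crossing_of_pathIn hrR (hnear hadj₂ hk₂ hc₂) hq₂R ha₂q
  refine ⟨p₁, q₁, p₂, q₂, hp₁, hq₁, hp₂, hq₂, hcross₁.mono inter_subset_right, hcross₂.mono inter_subset_right,
    fun h12 ↦ hn12 ?_⟩
  exact ha₁p₁.trans ((h12.mono hAnn).trans ha₂p₂.symm)

/-- **Covering lemma for `𝔅`, closed form** (anchor of this module; all parameters explicit): see `covering_B`. -/
theorem covering_B_nodes : ∀ (lam s : ℕ) (x : Site 2) (η : SiteConfig (Site 2)), 1 ≤ lam → lam + 1 ≤ s → η ∈ THook x x s s → η ∉ THookBig lam s x → ∃ F : Finset (Site 2), (∀ c ∈ F, c ∈ η ∧ c ∈ innerLayer triGraph (tBall x s) (tBall x (2 * s)) ∧ ¬ ∃ w ∈ blobOf (tColourGraph η true) (tBall x (2 * s) \ tBall x s) c, ∃ w' ∈ blobOf (tColourGraph η true) (tBall x (2 * s) \ tBall x s) c, (lam : ℤ) ≤ triNorm (w - w')) ∧ F.Nonempty ∧ (∃ v v' : Site 2, IsCrossing triGraph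 (tColourGraph η true) (tBall x s) (tBall x (2 * s)) v ∧ IsCrossing triGraph (tColourGraph η true) (tBall x s) (tBall x (2 * s)) v' ∧ ¬ PathIn (tColourGraph η true) (avoidSet s x η ↑F) v v' ∧ ∀ c ∈ F, ∃ a₁ c₁ a₂ c₂ : Site 2, PathIn (tColourGraph η true) (avoidSet s x η ↑F) v a₁ ∧ (tColourGraph η true).Adj a₁ c₁ ∧ c₁ ∈ blobOf (tColourGraph η true) (tBall x (2 * s) \ tBall x s) c ∧ PathIn (tColourGraph η true) (avoidSet s x η ↑F) v' a₂ ∧ (tColourGraph η true).Adj a₂ c₂ ∧ c₂ ∈ blobOf (tColourGraph η true) (tBall x (2 * s) \ tBall x s) c) ∧ ∀ 𝒩 ⊆ F, 𝒩.Nonempty → ∀ (w : Site 2) (Δ r R Γ : ℕ), w ∈ innerLayer triGraph (tBall x s) (tBall x (2 * s)) → (∀ c ∈ 𝒩, triNorm (c - w) ≤ Δ) → (∀ c ∈ F, c ∉ 𝒩 → (Γ : ℤ) ≤ triNorm (c - w)) → Δ + lam + 1 ≤ r → r ≤ R → R + lam ≤ Γ → R + 2 ≤ s → ∃ p₁ q₁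 p₂ q₂ : Site 2, triNorm (p₁ - w) = r ∧ triNorm (q₁ - w) = R ∧ triNorm (p₂ - w) = r ∧ triNorm (q₂ - w) = R ∧ PathIn (tColourGraph η true) (tAnn w r R) p₁ q₁ ∧ PathIn (tColourGraph η true) (tAnn w r R) p₂ q₂ ∧ ¬ PathIn (tColourGraph η true) (tAnn w r R) p₁ p₂ :=
  fun _ _ _ _ hlam hls hH hnB ↦ covering_B hlam hls hH hnB

end CoveringB

end Summit.CriticalPhenomena.CardyFormulaZ2.Cruxes.NestingRigidity.PinchResampling

end
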